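/-
Copyright: the b2b-balaban cell (near-miss cell 7), T⁴-continuum fan-out, lineage t4-ne7b-p3 (node U5c LARGE-DEVIATION
member P3).  Released under the licence of the surrounding project.
-/
import Summits.QuantumFields.BalabanUV.T4Continuum.Support.SpaceTimeRelabel
import Summits.QuantumFields.BalabanUV.T4Continuum.Support.SpaceTimeInstance
import Summits.QuantumFields.BalabanUV.T4Continuum.Support.SpaceTimeSeparation
import Summits.QuantumFields.BalabanUV.T4Continuum.Support.SpaceTimeJunction

/-!
# Space-time Peierls ∕ Cramér route for NE7b — THE LINEAGE READINGS ON THE COUNT CARRIER: realised histories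
# (`HistoryAdmissible.PGen` + `HistoryRealise.Realises`) per term ARE the lineage data, and reading (iv)
# (consistency ∕ well-formedness ∕ reach ∕ `SkelOK`) is DISCHARGED from `Realises ∧ PendingAt ∧ TypeNodup ∧ RenewAtReach`

Summits-side support leaf of the T⁴-continuum cell (rung (B)+1 on a FINITE torus only; NOT infinite volume, NOT the
mass gap, NOT the Clay statement; NOT a proof of the spine estimate NE7b).  Lineage `t4-ne7b-p3` (generation 3), node
U5c, skeleton `t4/skeletons/NE7b-t4-ne7b-p3.md` §12 (THE JUNCTION PACKAGED).  [folklore] assembly over this lineage's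
`SpaceTimeOccTorus` (`LinData`, `contourCover`, `card_contour_le_tree`), `SpaceTimeSeparation` (`separated_of_lat`),
`SpaceTimeJunction` (`pieceOf`, `skelOK_of_realises`), `SpaceTimeRelabel` (invariance under `ZoneSkeleton.gmap`),
`SpaceTimeAssembly.LineageReadings`, and the COUNT swarm's carriers `HistoryAdmissible.PGen` (p207789: `toGen`, `Adm`,
`TypeNodup`, `RenewAtReach`, `consistent_toGen`, `wf_toGen`) and `HistoryRealise` (p209120: `Realises`, `PendingAt`,
`lt_reach_of_pendingAt`, `joinInLife_of_realises`, `adm_of_realises`) — all imported BY NAME, nothing modified; nothing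
printed is asserted (that Bałaban's terms are indexed by realised histories is the COUNT swarm's displayed H3); no
`[cite:]` tag.

WHAT.
* §1 `exists_root_event`: a realised history has an event of step `rootStep` with NONEMPTY piece (the first-born
  region carries its anchor; through renewals and joins the piece only grows or is a connector).
* §2 **`RLin`** — REALISED LINEAGE DATA ON THE COUNT CARRIER: terms `T`, lineages `fam τ`, and for every lineage `λ`
  its history `P λ : PGen (ℤᵈ × Finset ℤᵈ)` and last domain `Z λ`, along the flow exponents `s`; **`RLin.toLinData`**:
  the lineage data of `SpaceTimeOccTorus` over the TAGGED labels `Λ × PEv` (genealogy of `λ` = the push-forward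
  `gmap (Prod.mk λ) (P λ).toGen`, piece of `(λ, e)` = `pieceOf L s (P λ) e` — one piece map per lineage, as the COUNT
  carrier has it), with `occAt_eq` ∕ `inLin_iff` ∕ `skelOK_lin` reading everything back on the canonical label
  `(P λ).toGen : Gen PEv` (`SpaceTimeRelabel`); **`RLin.LatSep`** — lateral separation stated on the carrier (occupied
  index points of distinct lineages of one term at one step have distinct, non-adjacent torus cells = print's merger
  criterion read contrapositively, p. 386) and `latSeparated : LatSep → toLinData.LatSeparated`.
* §3 **`RLin.lineageReadings`**: `LineageReadings D.toLinData.model C K Kc R g A Bad jlo nup (3^d+L^{2d}+1) ((Δ+1)²)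
  ((n·L^{Kx−ℓ K})^d) (8·126^d) (126^d) (127^d+3) c₃` HOLDS provided: the flow side conditions (`n > 0`, `L ≥ 4`, levels
  monotone with jumps `≤ 2` and `ratio L s u = L^{ℓ(u+1)−ℓ u}`, drop control on every horizon, sizes `R ≥ 1`, merger
  allowance `C.n₁ ≥ 13`, `K ≤ Kc`); (i) nonnegative weights; (ii′) every bad term has a lineage ROOTED at a step
  `≤ jlo` (the DEFINITION of the bad class: created before `j⋆`); (iii′) `LatSep`; (iv′) every lineage of every term is
  `Realises`-realised, `PendingAt` the cutoff `K`, `TypeNodup`, and `RenewAtReach (dictW R C.n₁)` — ALL FOUR ARE THE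
  COUNT CARRIER's OWN predicates (the last is its displayed finding F-1(c)); (v′) the factorisation and (vi) the
  remainder bound, stated on the canonical labels.  Inside: (iv′) ⇒ (iv) by `adm_of_realises` + `consistent_toGen` +
  `wf_toGen` + `joinInLife_of_realises` + `lt_reach_of_pendingAt` + `skelOK_of_realises` + `skelOK_gmap`; (ii′) ⇒ (ii) by
  `exists_root_event`; (iii′) ⇒ (iii) ⇒ `Separated` by `separated_of_lat`; then `contourCover`, `card_contour_le_tree`
  with `treeD_gmap` ∕ `treeSteps_gmap`, and the fields as in `LinData.lineageReadings`.
* §4 `RLin.runReadingsFlow`: the binder of the FLOW END `SpaceTimeAssembly.exists_irThreshold_relWeightBound`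
  inhabited from the same data plus the run's typed flow facts.
HONEST RESIDUE of the CONTOUR route after this file: H3-type identification of Bałaban's terms ∕ live components with
realised histories on this carrier (shared with the COUNT route), `TypeNodup` (ruling R-A) and `RenewAtReach` (F-1(c))
of that carrier, lateral separation (print's merger criterion), the factorisation (v′) and remainder (vi) (A3a ∕ A3e ∕
A3f, NOT PRINTED as statements), the flow facts (BetaPertH behind the banking ∕ IR threshold), (B) in `LowEnvelope`.

HONEST DEPENDENCY (cell, verbatim): continuum YM on T⁴ ⇐ BetaPertH ∧ nine spine estimates (0/9 proved); BetaPertH ⇐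
(D1) ∧ (D4) ∧ CAP+tail; G-an2-4 gates asym, D1 and NE2/3/4.  This file changes none of it.
-/

open Finset

namespace Summit.QuantumFields.BalabanUV.T4Continuum.SpaceTimePeierls

open Literature.MathematicalPhysics.QuantumFieldTheory.Balaban1983to89
open Literature.MathematicalPhysics.QuantumFieldTheory.Balaban1983to89.B13ScaleTransfer
open Literature.MathematicalPhysics.QuantumFieldTheory.Balaban1983to89.B16SProfile
open T4PersistenceDictionary T4BankedInduction T4PrintedShapeBanking
open Summit.QuantumFields.BalabanUV.T4Continuum.ZoneTorus
open Summit.QuantumFields.BalabanUV.T4Continuum.ZoneSkeleton (gmap events_gmap)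
open Summit.QuantumFields.BalabanUV.T4Continuum.HistoryAdmissible
open Summit.QuantumFields.BalabanUV.T4Continuum.HistoryRealise
open SpaceTimePeierlsLeaves

noncomputable section

open Classical

/-! ## §1 The root event of a realised history -/

section Root

variable {d L : ℕ} {s R : ℕ → ℕ}

/-- **THE ROOT EVENT**: a realised history has an event of step `rootStep` whose piece is nonempty (the first-born
region contains its anchor; a renewal keeps the pieces; at a join the piece of a partner's event is enlarged or, for
the join label itself, a connector). [folklore] -/
theorem exists_root_event :
    ∀ {P : PGen (Pt d × Finset (Pt d))} {Z : Finset (Pt d)}, Realises L s R P Z →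
      ∃ e ∈ P.toGen.events, PEv.step e = P.rootStep ∧ (pieceOf L s P e).Nonempty
  | .birth j cls zZ, Z, hRZ => by
      obtain ⟨hzZ, hz, -, -⟩ := hRZ
      refine ⟨((j, 0, cls) : PEv), by simp [PGen.toGen], rfl, ?_⟩
      have hpc : pieceOf L s (.birth j cls zZ) ((j, 0, cls) : PEv) = Z := by simp [pieceOf, hzZ]
      rw [hpc]
      exact ⟨_, hz⟩
  | .renew G h, Z, hRZ => by
      obtain ⟨ZG, hG, -, -, -⟩ := hRZ
      obtain ⟨e, he, hst, hne⟩ := exists_root_event hG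
      refine ⟨e, ?_, ?_, ?_⟩
      · simp only [PGen.toGen, Gen.events_renew, mem_insert]
        exact Or.inr he
      · simpa only [PGen.rootStep] using hst
      · simpa only [pieceOf] using hne
  | .join X Y sj, Z, hRZ => by
      obtain ⟨ZX, ZY, hX, hY, -, -, -, -, -, -⟩ := hRZ
      by_cases hle : X.rootStep ≤ Y.rootStep
      · obtain ⟨e, he, hst, hne⟩ := exists_root_event hX
        refine ⟨e, ?_, ?_, ?_⟩
        · simp only [PGen.toGen, Gen.events_merge, mem_insert, mem_union]
          exact Or.inr (Or.inl he)
        · simp only [PGen.rootStep, hst]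
          exact (min_eq_left hle).symm
        · simp only [pieceOf]
          split_ifs
          · exact connector_nonempty _
          · exact hne.mono subset_union_left
      · obtain ⟨e, he, hst, hne⟩ := exists_root_event hY
        refine ⟨e, ?_, ?_, ?_⟩
        · simp only [PGen.toGen, Gen.events_merge, mem_insert, mem_union]
          exact Or.inr (Or.inr he)
        · simp only [PGen.rootStep, hst]
          exact (min_eq_right (by omega)).symm
        · simp only [pieceOf]
          split_ifs
          · exact connector_nonempty _
          · exact hne.mono subset_union_right

end Root

/-! ## §2 Realised lineage data on the COUNT carrier -/

/-- **REALISED LINEAGE DATA ON THE COUNT CARRIER** for one run over the cutoff torus `n·L^{Kx}` with level map `ℓ`: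
the torus side is positive, the levels of the steps `≤ K` fit, the terms `T`, the lineages `fam τ` (final live
components) of each term, and for every lineage its HISTORY `P λ` (the COUNT swarm's skeleton with region payload,
`HistoryAdmissible.PGen (ℤᵈ × Finset ℤᵈ)`) and its domain `Z λ` at the last event; `s` = the flow's window exponents.
[folklore] -/
structure RLin (d n L Kx K : ℕ) (ℓ : ℕ → ℕ) (ι Λ : Type*) where
  /-- the torus is nonempty -/
  hN : 0 < n * L ^ Kx
  /-- the levels of the steps `≤ K` fit in the torus -/
  hℓK : ∀ u, u ≤ K → ℓ u ≤ Kx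
  /-- the terms of the run -/
  T : Finset ι
  /-- the lineages (final live components) of a term -/
  fam : ι → Finset Λ
  /-- the history of a lineage -/
  P : Λ → PGen (Pt d × Finset (Pt d))
  /-- the domain of a lineage at its last event -/
  Z : Λ → Finset (Pt d)
  /-- the flow's window exponents (`R_u = L^{s u}`) -/
  s : ℕ → ℕ

namespace RLin

variable {d n L Kx K : ℕ} {ℓ : ℕ → ℕ} {ι Λ : Type*} (D : RLin d n L Kx K ℓ ι Λ)

/-- **THE LINEAGE DATA OVER TAGGED LABELS**: events of the lineage `λ` are tagged `(λ, e)`; the genealogy of `λ` is the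
push-forward of the canonical label `(P λ).toGen`; the ratios are the flow's; the step of `(λ, e)` is the step of
`e`; the piece of `(λ, e)` is `pieceOf L s (P λ) e` (one piece map per lineage). [folklore] -/
def toLinData : LinData d n L Kx K ℓ ι Λ (Λ × PEv) where
  hN := D.hN
  hℓK := D.hℓK
  T := D.T
  fam := D.fam
  G := fun lam => gmap (Prod.mk lam) (D.P lam).toGen
  q := ratio L D.s
  step := fun p => PEv.step p.2
  piece := fun p => pieceOf L D.s (D.P p.1) p.2

/-- the class read off a tagged label [folklore] -/
def fatT : Λ × PEv → ℕ := fun p => PEv.fat p.2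

/-- the terms of the tagged data [folklore] -/
@[simp] theorem toLinData_T : D.toLinData.T = D.T := rfl

/-- the lineages of the tagged data [folklore] -/
@[simp] theorem toLinData_fam : D.toLinData.fam = D.fam := rfl

/-- the genealogies of the tagged data [folklore] -/
theorem toLinData_G (lam : Λ) : D.toLinData.G lam = gmap (Prod.mk lam) (D.P lam).toGen := rfl

/-- the ratios of the tagged data [folklore] -/
@[simp] theorem toLinData_q : D.toLinData.q = ratio L D.s := rfl

/-- the tree sum of the profile of a tagged lineage is that of the canonical label [folklore] -/
theorem treeD_eq (dC : ℝ) (lam : Λ) (t : ℕ) :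
    treeD fatT D.toLinData.step dC (D.toLinData.G lam) t = treeD PEv.fat PEv.step dC (D.P lam).toGen t :=
  treeD_gmap (Prod.mk lam) (step := PEv.step) (fat := PEv.fat) (fun _ => rfl) (fun _ => rfl) _ t

/-- the structure-step count of a tagged lineage is that of the canonical label [folklore] -/
theorem treeSteps_eq (lam : Λ) (t : ℕ) :
    treeSteps D.toLinData.step (D.toLinData.G lam) t = treeSteps PEv.step (D.P lam).toGen t :=
  treeSteps_gmap (Prod.mk lam) (step := PEv.step) (fun _ => rfl) _ t

variable [DecidableEq Λ]

/-- **THE OCCUPIED SETS ARE THOSE OF THE CANONICAL LABEL** (`occAt_gmap`). [folklore] -/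
theorem occAt_eq (lam : Λ) (u : ℕ) :
    occAt D.toLinData.q D.toLinData.step D.toLinData.piece (D.toLinData.G lam) u =
      occAt (ratio L D.s) PEv.step (pieceOf L D.s (D.P lam)) (D.P lam).toGen u :=
  occAt_gmap (Prod.mk lam) (step := PEv.step) (piece := pieceOf L D.s (D.P lam)) (fun _ => rfl) (fun _ => rfl) _ u

/-- **`InLin` READ ON THE CARRIER**: a cell belongs to the lineage `λ` iff it is the torus cell of an index point
occupied by the history `P λ` at the cell's step. [folklore] -/
theorem inLin_iff {lam : Λ} {c : STCellV d n L Kx K ℓ} :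
    D.toLinData.InLin lam c ↔
      ∃ y ∈ occAt (ratio L D.s) PEv.step (pieceOf L D.s (D.P lam)) (D.P lam).toGen c.sc,
        c.pt = toCell (n * L ^ Kx) (L ^ ℓ c.sc) D.hN y := by
  unfold LinData.InLin
  rw [occAt_eq]

/-- **`SkelOK` OF A TAGGED LINEAGE** from the junction theorem: a realised history with distinct event types, observed
by a cutoff, is a realised lineage of the tagged data (`skelOK_of_realises` + `skelOK_gmap`). [folklore] -/
theorem skelOK_lin (hL : 4 ≤ L) (hdrop : ∀ m, DropCtl D.s m) {R : ℕ → ℕ} {lam : Λ} {Kc : ℕ}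
    (hT : (D.P lam).TypeNodup) (hA : (D.P lam).Adm Kc) (hRl : Realises L D.s R (D.P lam) (D.Z lam)) :
    SkelOK D.toLinData.q D.toLinData.step D.toLinData.piece fatT ((127 : ℝ) ^ d + 3) (D.toLinData.G lam) :=
  skelOK_gmap (Prod.mk lam) (step := PEv.step) (piece := pieceOf L D.s (D.P lam)) (fat := PEv.fat)
    (fun _ => rfl) (fun _ => rfl) (fun _ => rfl) (skelOK_of_realises hL hdrop hT hA hRl).1

/-- **LATERAL SEPARATION ON THE CARRIER** (print's merger criterion «the corresponding domains intersect, or touch each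
other», B16 p. 386, read contrapositively: distinct live components of one term neither intersect nor touch): at every
step `u ≤ K`, occupied index points of distinct lineages of one term have DISTINCT torus cells that are NOT laterally
adjacent. A displayed reading. [folklore] -/
def LatSep : Prop :=
  ∀ τ ∈ D.T, ∀ lam₁ ∈ D.fam τ, ∀ lam₂ ∈ D.fam τ, lam₁ ≠ lam₂ → ∀ u, u ≤ K →
    ∀ y₁ ∈ occAt (ratio L D.s) PEv.step (pieceOf L D.s (D.P lam₁)) (D.P lam₁).toGen u,
    ∀ y₂ ∈ occAt (ratio L D.s) PEv.step (pieceOf L D.s (D.P lam₂)) (D.P lam₂).toGen u,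
      toCell (n * L ^ Kx) (L ^ ℓ u) D.hN y₁ ≠ toCell (n * L ^ Kx) (L ^ ℓ u) D.hN y₂ ∧
      ¬ nearT n L Kx (toCell (n * L ^ Kx) (L ^ ℓ u) D.hN y₁) (ℓ u) (toCell (n * L ^ Kx) (L ^ ℓ u) D.hN y₂)
          (ℓ u) (ℓ u) 1

/-- carrier-level lateral separation is the tagged data's `LatSeparated` [folklore] -/
theorem latSeparated (h : D.LatSep) : D.toLinData.LatSeparated := by
  refine ⟨fun τ hτ lam₁ h₁ lam₂ h₂ hne c₁ c₂ hc₁ hc₂ hsc => ?_⟩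
  obtain ⟨y₁, hy₁, hp₁⟩ := D.inLin_iff.1 hc₁
  obtain ⟨y₂, hy₂, hp₂⟩ := D.inLin_iff.1 hc₂
  have hK : c₁.sc ≤ K := Nat.le_of_lt_succ c₁.1.1.isLt
  rw [← hsc] at hy₂ hp₂
  obtain ⟨hne', hfar⟩ := h τ (by simpa using hτ) lam₁ (by simpa using h₁) lam₂ (by simpa using h₂) hne c₁.sc hK
    y₁ hy₁ y₂ hy₂
  refine ⟨fun hcc => hne' ?_, ?_⟩
  · rw [← hp₁, ← hp₂, hcc]
  · rw [← hsc, hp₁, hp₂]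
    exact hfar

/-! ## §3 The lineage readings on the COUNT carrier -/

/-- **THE LINEAGE READINGS ON THE COUNT CARRIER.**  See the module docstring: the entropy fields, the contour cover,
the cell clause AND the per-lineage consistency ∕ well-formedness ∕ reach ∕ `SkelOK` are proved; displayed are the
flow side conditions, nonnegativity, the rooting of bad terms before `jlo` (definition of the bad class), lateral
separation, `Realises ∧ PendingAt ∧ TypeNodup ∧ RenewAtReach` per lineage (the COUNT carrier's predicates), the
factorisation and the remainder bound on the canonical labels. [folklore] -/
theorem lineageReadings {C : T4PrintedShapeBanking.Consts} {Kc : ℕ} {R : ℕ → ℕ} {g : ℕ → ℝ} {A : ι → ℝ}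
    {Bad : Finset ι} {jlo : ℕ} {nup c₃ : ℝ} {rest : Finset (STCellV d n L Kx K ℓ) → ι → ℝ}
    -- the flow
    (hn : 0 < n) (hL : 4 ≤ L) (hmono : ∀ u, ℓ u ≤ ℓ (u + 1)) (hjump : ∀ u, ℓ (u + 1) ≤ ℓ u + 2)
    (hqℓ : ∀ u, ratio L D.s u = L ^ (ℓ (u + 1) - ℓ u)) (hdrop : ∀ m, DropCtl D.s m) (hR : ∀ t, 1 ≤ R t)
    (hn₁ : 13 ≤ C.n₁) (hKc : K ≤ Kc)
    -- (i) nonnegative weights; the bad class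
    (hnonneg : ∀ τ ∈ D.T, 0 ≤ A τ) (hBad : Bad ⊆ D.T) (hjlo : jlo ≤ K)
    -- (ii′) the old structure: a bad term has a lineage rooted at a step `≤ jlo`
    (hold : ∀ τ ∈ Bad, ∃ lam ∈ D.fam τ, (D.P lam).rootStep ≤ jlo)
    -- (iii′) lateral separation
    (hsep : D.LatSep)
    -- (iv′) realised, pending at the cutoff, distinct event types, renewal at the booked reach
    (hreal : ∀ τ ∈ D.T, ∀ lam ∈ D.fam τ, Realises L D.s R (D.P lam) (D.Z lam) ∧
      PendingAt L D.s R (D.P lam).lastStep (D.Z lam) K ∧ (D.P lam).TypeNodup ∧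
      (D.P lam).RenewAtReach (dictW R C.n₁))
    -- (v′) factorisation on the canonical label of the lineage containing the contour
    (hfac : ∀ (𝒦 : Finset (STCellV d n L Kx K ℓ)), ∀ τ ∈ D.T, D.toLinData.model.IsContour τ 𝒦 → ∀ lam ∈ D.fam τ,
      (∀ c ∈ 𝒦, D.toLinData.InLin lam c) →
        A τ ≤ Real.exp (-(credits (credit C g) (D.P lam).toGen -
          lifeCost (dictW R C.n₁) (cost C Kc R) (D.P lam).toGen)) * rest 𝒦 τ)
    -- (vi) the remainder
    (hrest0 : ∀ (𝒦 : Finset (STCellV d n L Kx K ℓ)), ∀ τ ∈ D.T, 0 ≤ rest 𝒦 τ)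
    (hrest : ∀ (𝒦 : Finset (STCellV d n L Kx K ℓ)),
      ∑ τ ∈ D.toLinData.model.T.filter (fun τ => D.toLinData.model.IsContour τ 𝒦), rest 𝒦 τ ≤
        Real.exp c₃ ^ 𝒦.card * nup) :
    LineageReadings D.toLinData.model C K Kc R g A Bad jlo nup (3 ^ d + L ^ (2 * d) + 1)
      ((((3 ^ d + L ^ (2 * d) + 1 : ℕ) : ℝ) + 1) ^ 2) (((n * L ^ (Kx - ℓ K)) ^ d : ℕ) : ℝ)
      (8 * 126 ^ d) (126 ^ d) ((127 : ℝ) ^ d + 3) c₃ := by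
  -- (iv′) ⇒ (iv): the per-lineage facts on the canonical label and on the tagged lineage
  have hlin : ∀ τ ∈ D.T, ∀ lam ∈ D.fam τ,
      Consistent C Kc R (D.P lam).toGen ∧ (D.P lam).toGen.WF (dictW R C.n₁) ∧
      K + 1 ≤ (D.P lam).toGen.reach (dictW R C.n₁) ∧
      SkelOK D.toLinData.q D.toLinData.step D.toLinData.piece fatT ((127 : ℝ) ^ d + 3) (D.toLinData.G lam) := by
    intro τ hτ lam hlam
    obtain ⟨hRl, hPd, hT, hRn⟩ := hreal τ hτ lam hlam
    have hlast : (D.P lam).lastStep ≤ K := hPd.1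
    have hAK : (D.P lam).Adm Kc := adm_of_realises _ _ hRl (hlast.trans hKc)
    have hJ : (D.P lam).JoinInLife (dictW R C.n₁) := joinInLife_of_realises hL hdrop hR hn₁ _ _ hRl
    exact ⟨PGen.consistent_toGen C Kc R hAK hRn hJ, PGen.wf_toGen _ hT hAK hRn hJ,
      lt_reach_of_pendingAt hL hdrop hR hn₁ hRl hPd, D.skelOK_lin hL hdrop hT hAK hRl⟩
  -- (iii′) ⇒ separation in the space-time cell graph
  have hsep' : D.toLinData.Separated :=
    D.toLinData.separated_of_lat (fat := fatT) (dC := (127 : ℝ) ^ d + 3) (by omega) hmono hqℓ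
      (fun τ hτ lam hlam => (hlin τ hτ lam hlam).2.2.2) (D.latSeparated hsep)
  -- the lineage containing a contour, with its cell bound on the canonical label
  have key : ∀ (τ : ι) (𝒦 : Finset (STCellV d n L Kx K ℓ)), τ ∈ D.T ∧ D.toLinData.model.IsContour τ 𝒦 →
      ∃ lam ∈ D.fam τ, (∀ c ∈ 𝒦, D.toLinData.InLin lam c) ∧
        (𝒦.card : ℝ) ≤ 8 * 126 ^ d * treeD PEv.fat PEv.step ((127 : ℝ) ^ d + 3) (D.P lam).toGen (K + 1) +
          126 ^ d * treeSteps PEv.step (D.P lam).toGen (K + 1) := by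
    intro τ 𝒦 h
    obtain ⟨lam, hlam, hin, hct⟩ := D.toLinData.card_contour_le_tree (fat := fatT) hsep' h.1 h.2 hL rfl (hdrop K)
      le_rfl (by positivity) fun lam hlam => (hlin τ h.1 lam hlam).2.2.2
    refine ⟨lam, hlam, hin, ?_⟩
    rw [D.treeD_eq, D.treeSteps_eq] at hct
    exact hct
  refine
    { deg := fun c => degree_stGraphV_le (by omega) hjump c
      animal := siteAnimalBound_sq (3 ^ d + L ^ (2 * d) + 1)
      anchors := ?_
      nonneg := hnonneg
      cover := D.toLinData.contourCover (fat := fatT) (dC := (127 : ℝ) ^ d + 3) hn (by omega) hmono hqℓ hBad hjlo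
        fun τ hτ => ?_
      lineage := ?_ }
  · have h := card_anchorsV_le (d := d) (n := n) (L := L) (Kx := Kx) (K := K) (ℓ := ℓ) (by omega) (D.hℓK K le_rfl)
    exact_mod_cast h
  · -- (ii′) ⇒ (ii): the root event of a lineage rooted before `jlo`
    obtain ⟨lam, hlam, hroot⟩ := hold τ hτ
    obtain ⟨hRl, -, -, -⟩ := hreal τ (hBad hτ) lam hlam
    obtain ⟨e, he, hst, hne⟩ := exists_root_event hRl
    refine ⟨lam, hlam, (hlin τ (hBad hτ) lam hlam).2.2.2, (lam, e), ?_, ?_, hne⟩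
    · rw [toLinData_G, events_gmap]
      exact mem_image_of_mem _ he
    · show PEv.step e ≤ jlo
      rw [hst]
      exact hroot
  · refine ⟨fun τ 𝒦 => if h : τ ∈ D.T ∧ D.toLinData.model.IsContour τ 𝒦 then
        (D.P (Classical.choose (key τ 𝒦 h))).toGen else Gen.born default 0, rest, fun _ _ => K + 1,
        fun 𝒦 τ hτ h𝒦 => ?_, hrest0, hrest⟩
    have hgen : (if h : τ ∈ D.T ∧ D.toLinData.model.IsContour τ 𝒦 then
        (D.P (Classical.choose (key τ 𝒦 h))).toGen else Gen.born default 0) =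
          (D.P (Classical.choose (key τ 𝒦 ⟨hτ, h𝒦⟩))).toGen := dif_pos ⟨hτ, h𝒦⟩
    beta_reduce
    rw [hgen]
    obtain ⟨hlam, hin, hcard⟩ := Classical.choose_spec (key τ 𝒦 ⟨hτ, h𝒦⟩)
    obtain ⟨hcons, hwf, hreach, -⟩ := hlin τ hτ _ hlam
    exact ⟨hcons, hwf, hreach, hcard, hfac 𝒦 τ hτ h𝒦 _ hlam hin⟩

/-! ## §4 The binder of the flow end, inhabited from the carrier -/

/-- **`RunReadingsFlow` AT ONE `(K, t)` FROM REALISED LINEAGE DATA ON THE COUNT CARRIER.**  The data `D` of the run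
at `(K, t)` (terms `D.T = T K`), the hypotheses of `RLin.lineageReadings` for the weights `X K t`, bad class
`Bad K t`, window floor `jstar K`, envelope `xup K t`, and the run's typed flow facts with the infrared value `x₀`,
inhabit the binder `RunReadingsFlow` of `SpaceTimeAssembly.exists_irThreshold_relWeightBound` with
`Δ₁ = (3^d + L^{2d} + 2)²`, `Nanc = (n·L^{Kx − ℓ K})^d`, `cA = 8·126^d`, `cB = 126^d`, `dC = 127^d + 3`. [folklore] -/
theorem runReadingsFlow {C : T4PrintedShapeBanking.Consts} {r : ℕ} {β₀ x₀ β' : ℝ} {T : ℕ → Finset ι}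
    {X : ℕ → ℝ → ι → ℝ} {Bad : ℕ → ℝ → Finset ι} {xup : ℕ → ℝ → ℝ} {jstar : ℕ → ℕ} {c₃ : ℝ} {t : ℝ}
    {Kc : ℕ} {R : ℕ → ℕ} {g : ℕ → ℝ} {rest : Finset (STCellV d n L Kx K ℓ) → ι → ℝ}
    (hT : D.T = T K)
    -- the typed flow facts of the run and the infrared value
    (h27 : B14.FlowIneq27 g β' β₀ C.p₀ Kc) (h29 : B14FlowStep.FlowIneq29 R g L β' β₀ Kc)
    (hRj : ∀ s, s ≤ Kc → B14.IsRj L r (g s) (R s)) (hx1 : ∀ s, s ≤ Kc → 1 ≤ Real.log ((g s) ^ 2)⁻¹)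
    (hxK : x₀ ≤ Real.log ((g Kc) ^ 2)⁻¹)
    -- the hypotheses of `RLin.lineageReadings`
    (hn : 0 < n) (hL : 4 ≤ L) (hmono : ∀ u, ℓ u ≤ ℓ (u + 1)) (hjump : ∀ u, ℓ (u + 1) ≤ ℓ u + 2)
    (hqℓ : ∀ u, ratio L D.s u = L ^ (ℓ (u + 1) - ℓ u)) (hdrop : ∀ m, DropCtl D.s m) (hR : ∀ t, 1 ≤ R t)
    (hn₁ : 13 ≤ C.n₁) (hKc : K ≤ Kc)
    (hnonneg : ∀ τ ∈ D.T, 0 ≤ X K t τ) (hBad : Bad K t ⊆ D.T) (hjlo : jstar K ≤ K)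
    (hold : ∀ τ ∈ Bad K t, ∃ lam ∈ D.fam τ, (D.P lam).rootStep ≤ jstar K)
    (hsep : D.LatSep)
    (hreal : ∀ τ ∈ D.T, ∀ lam ∈ D.fam τ, Realises L D.s R (D.P lam) (D.Z lam) ∧
      PendingAt L D.s R (D.P lam).lastStep (D.Z lam) K ∧ (D.P lam).TypeNodup ∧
      (D.P lam).RenewAtReach (dictW R C.n₁))
    (hfac : ∀ (𝒦 : Finset (STCellV d n L Kx K ℓ)), ∀ τ ∈ D.T, D.toLinData.model.IsContour τ 𝒦 → ∀ lam ∈ D.fam τ,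
      (∀ c ∈ 𝒦, D.toLinData.InLin lam c) →
        X K t τ ≤ Real.exp (-(credits (credit C g) (D.P lam).toGen -
          lifeCost (dictW R C.n₁) (cost C Kc R) (D.P lam).toGen)) * rest 𝒦 τ)
    (hrest0 : ∀ (𝒦 : Finset (STCellV d n L Kx K ℓ)), ∀ τ ∈ D.T, 0 ≤ rest 𝒦 τ)
    (hrest : ∀ (𝒦 : Finset (STCellV d n L Kx K ℓ)),
      ∑ τ ∈ D.toLinData.model.T.filter (fun τ => D.toLinData.model.IsContour τ 𝒦), rest 𝒦 τ ≤
        Real.exp c₃ ^ 𝒦.card * xup K t) :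
    RunReadingsFlow C L r β₀ x₀ T X Bad xup jstar ((((3 ^ d + L ^ (2 * d) + 1 : ℕ) : ℝ) + 1) ^ 2)
      (((n * L ^ (Kx - ℓ K)) ^ d : ℕ) : ℝ) (8 * 126 ^ d) (126 ^ d) ((127 : ℝ) ^ d + 3) c₃ K t :=
  ⟨STCellV d n L Kx K ℓ, inferInstance, inferInstance, D.toLinData.model, inferInstance, 3 ^ d + L ^ (2 * d) + 1, Kc,
    R, g, β', hT, h27, h29, hRj, hx1, hxK,
    D.lineageReadings hn hL hmono hjump hqℓ hdrop hR hn₁ hKc hnonneg hBad hjlo hold hsep hreal hfac hrest0 hrest⟩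

end RLin

end

end Summit.QuantumFields.BalabanUV.T4Continuum.SpaceTimePeierls
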